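import Summits.ABC.StewartYu.PadicW80Par3C
import HarnessLib

/-!
# The `q = 3` (`p = 2`) parameter record — part D: the `Δ`-polynomial count `h L_b` and the ENDGAME numbers

Support file (theorems only; no named facts), cell `abc-stewartyu` (p1; crux `W80Two` stmt-ABC-19486; design memo
HOME/p1/S2-q3-record-design.md).  Base-`3` twin of `PadicW80ParLC` (§`h, L_b`: `h L_b G ≤ 𝔘/c_L + W⋆ + G`,
`h L_b ℓ ≤ …`) and of `PadicW80ParLE` (the endgame numbers): with `T' := ⌊T/3^{J₀}⌋ − ∑ⱼ ⌊Lⱼ/3^{J₀}⌋`,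
`∑ⱼ ⌊Lⱼ/3^{J₀}⌋ + 1 ≤ ⌊T/3^{J₀}⌋` and `h L_b < T' · #{s < 3^{J₀} S₀ : 3 ∤ s}` where the count is the closed form
`kpts3 J₀ 0 = 2·3^{J₀}·(S₀/3)` (= `#Pts3 (3^{J₀} S₀)` of `DescentLevelsThirdQ` by `card_Pts3`) — the inputs
`hT'`, `hcount` of p2-g3's `w80_endgame3` (`hLθ : L_θ < 3^{J₀}` is `Lθ3_lt_three_pow`).
Everything is [folklore] bookkeeping on [cite: Waldschmidt1980, §3.5 (p. 274)] and [cite: Yu1989, §3].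
-/

noncomputable section

open Finset Real

namespace Summit.ABC.StewartYu

open PadicW80Par (cTp cSp cLp cLp' Ap mRp)

namespace PadicW80ParL

variable {d : ℕ} (P : PadicW80ParL d)

/-! ### `h L_b` -/

/-- `1 ≤ L_b`. [folklore] -/
theorem one_le_Lb3 : 1 ≤ P.Lb3 := Nat.le_add_left 1 _

/-- **`h L_b G ≤ 𝔘/c_L + W⋆ + G`.** [folklore] -/
theorem hparLb3G_le : (P.hparℓ : ℝ) * P.Lb3 * P.Gℓ ≤ P.𝔘3 / cLp + (P.Wstarℓ + P.Gℓ) := by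
  have hh := P.hpar_pos; have hG := P.G_pos; have hU := P.U_pos
  have hLb : (P.Lb3 : ℝ) ≤ P.Uℓ / (cLp * 3 ^ (d + 1) * P.Gℓ * P.hparℓ) + 1 := by
    unfold Lb3; push_cast
    have := Nat.floor_le (show 0 ≤ P.Uℓ / (cLp * 3 ^ (d + 1) * P.Gℓ * P.hparℓ) by unfold cLp; positivity)
    linarith
  have e : P.Uℓ / (cLp * 3 ^ (d + 1) * P.Gℓ * P.hparℓ) = P.𝔘3 / cLp / (P.Gℓ * P.hparℓ) := by
    rw [P.U_eq3]; unfold cLp; field_simp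
  rw [e] at hLb
  have h2 := P.hparG_le
  calc (P.hparℓ : ℝ) * P.Lb3 * P.Gℓ ≤ P.hparℓ * (P.𝔘3 / cLp / (P.Gℓ * P.hparℓ) + 1) * P.Gℓ := by gcongr
    _ = P.𝔘3 / cLp + P.hparℓ * P.Gℓ := by field_simp
    _ ≤ P.𝔘3 / cLp + (P.Wstarℓ + P.Gℓ) := by linarith

/-- `h L_b ≤ 𝔘/c_L + 4W⋆`. [folklore] -/
theorem hparLb3_le : (P.hparℓ : ℝ) * P.Lb3 ≤ P.𝔘3 / cLp + 4 * P.Wstarℓ := by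
  have h := P.hparLb3G_le; have hG := P.one_le_G; have hGW := P.G_le_three_Wstar
  have h0 : 0 ≤ (P.hparℓ : ℝ) * P.Lb3 := by positivity
  have hU : 0 ≤ P.𝔘3 / cLp := by unfold cLp; have := P.𝔘3_pos; positivity
  nlinarith

/-- **`h L_b ℓ ≤ 𝔘/c_L + W⋆ + G`** (the floor `ℓ ≤ G`). [folklore] -/
theorem hparLb3ℓ_le : (P.hparℓ : ℝ) * P.Lb3 * P.ℓ ≤ P.𝔘3 / cLp + (P.Wstarℓ + P.Gℓ) := by
  have h := P.hparLb3G_le; have hG := P.ℓ_le_G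
  have h0 : 0 ≤ (P.hparℓ : ℝ) * P.Lb3 := by positivity
  exact (mul_le_mul_of_nonneg_left hG h0).trans h

/-- `h L_b ℓ ≤ 𝔘/2¹³` (`c_L = 2¹⁴`, `W⋆ + G ≤ 4W⋆ ≤ 𝔘/2⁹⁴`). [folklore] -/
theorem hparLb3ℓ_le' : (P.hparℓ : ℝ) * P.Lb3 * P.ℓ ≤ P.𝔘3 / 2 ^ 13 := by
  have h := P.hparLb3ℓ_le; have hGW := P.G_le_three_Wstar; have hWU := P.Wstar_le_𝔘3; have hU := P.𝔘3_pos
  unfold cLp at h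
  linarith

/-! ### The endgame numbers -/

/-- `∑ⱼ ⌊Lⱼ/3^{J₀}⌋ ≤ 4 m nV_θ` (real): `Lⱼ ≤ (2L_θ+2)V_θ/ℓ` by the floor `Vⱼ ≥ ℓ`, `3^{J₀} > L_θ`. [folklore] -/
theorem sum_L3_div_le : ((∑ j, P.L3 j / 3 ^ P.J₀3 : ℕ) : ℝ) ≤ 4 * mRp d * P.nVθ := by
  have hLθ := P.Lθ3_ge
  have hden := P.den_Lθ3_pos
  have hL1 : (1 : ℝ) ≤ P.Lθ3 := by exact_mod_cast P.one_le_Lθ3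
  have hJ : (P.Lθ3 : ℝ) < (3 : ℝ) ^ P.J₀3 := by exact_mod_cast P.Lθ3_lt_three_pow
  have hVθ := P.one_le_nVθ
  have hℓ := P.ℓ_pos
  have hj : ∀ j, ((P.L3 j / 3 ^ P.J₀3 : ℕ) : ℝ) ≤ 4 * P.nVθ := by
    intro j
    have h1 : ((P.L3 j / 3 ^ P.J₀3 : ℕ) : ℝ) ≤ (P.L3 j : ℝ) / 3 ^ P.J₀3 := by
      have := Nat.cast_div_le (α := ℝ) (m := P.L3 j) (n := 3 ^ P.J₀3); push_cast at this; exact this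
    have h0 : 0 < cLp' * mRp d * 3 ^ (d + 2) * (P.S₀3 : ℝ) := by unfold cLp'; have := mR_pos P; have := P.S₀3_pos; positivity
    have hVj := P.hVℓ j
    have hU := P.U_pos
    have hLj := P.L3_le j
    have h3 : P.Uℓ / (cLp' * mRp d * 3 ^ (d + 2) * P.S₀3 * P.V j) ≤
        P.Uℓ / (cLp' * mRp d * 3 ^ (d + 2) * P.S₀3 * P.Vθ) * P.nVθ := by
      have h3a : P.Uℓ / (cLp' * mRp d * 3 ^ (d + 2) * P.S₀3 * P.V j) ≤ P.Uℓ / (cLp' * mRp d * 3 ^ (d + 2) * P.S₀3 * P.ℓ) :=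
        div_le_div_of_nonneg_left hU.le (by positivity) (mul_le_mul_of_nonneg_left hVj h0.le)
      have h3b : P.Uℓ / (cLp' * mRp d * 3 ^ (d + 2) * P.S₀3 * P.ℓ) =
          P.Uℓ / (cLp' * mRp d * 3 ^ (d + 2) * P.S₀3 * P.Vθ) * P.nVθ := by
        have hVθ0 : P.Vθ ≠ 0 := by linarith [P.hVθ1]
        unfold nVθ; field_simp
      rw [← h3b]; exact h3a
    have h5 : (P.L3 j : ℝ) ≤ (2 * P.Lθ3 + 2) * P.nVθ := hLj.trans (h3.trans (by nlinarith))
    have h6 : (P.L3 j : ℝ) / 3 ^ P.J₀3 ≤ (2 * P.Lθ3 + 2) * P.nVθ / P.Lθ3 := by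
      calc (P.L3 j : ℝ) / 3 ^ P.J₀3 ≤ (P.L3 j : ℝ) / P.Lθ3 := div_le_div_of_nonneg_left (Nat.cast_nonneg _) (by linarith) hJ.le
        _ ≤ (2 * P.Lθ3 + 2) * P.nVθ / P.Lθ3 := div_le_div_of_nonneg_right h5 (by linarith)
    have h7 : (2 * P.Lθ3 + 2) * P.nVθ / P.Lθ3 ≤ 4 * P.nVθ := by
      rw [div_le_iff₀ (by linarith)]; nlinarith
    linarith
  push_cast
  calc ∑ j, ((P.L3 j / 3 ^ P.J₀3 : ℕ) : ℝ) ≤ ∑ _j : Fin d, 4 * P.nVθ := sum_le_sum fun j _ => hj j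
    _ = d * (4 * P.nVθ) := by simp
    _ ≤ 4 * mRp d * P.nVθ := by unfold mRp; nlinarith

/-- `⌊T/3^{J₀}⌋ ≥ 2⁹ m² nV_θ − 1` (real; `T ≥ 2¹¹ m² nV_θ L_θ`, `3^{J₀} ≤ 3 L_θ`). [folklore] -/
theorem T3_div_ge : (2 : ℝ) ^ 9 * mRp d ^ 2 * P.nVθ - 1 ≤ ((P.T3 / 3 ^ P.J₀3 : ℕ) : ℝ) := by
  have h1 : (P.T3 : ℝ) / ((3 ^ P.J₀3 : ℕ) : ℝ) - 1 ≤ ((P.T3 / 3 ^ P.J₀3 : ℕ) : ℝ) := by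
    have hb : 0 < 3 ^ P.J₀3 := Nat.pow_pos (by norm_num)
    have h := Nat.lt_div_mul_add hb (a := P.T3)
    have hb' : (0 : ℝ) < ((3 ^ P.J₀3 : ℕ) : ℝ) := by exact_mod_cast hb
    rw [div_sub_one hb'.ne', div_le_iff₀ hb']
    have : (P.T3 : ℝ) < (P.T3 / 3 ^ P.J₀3 : ℕ) * ((3 ^ P.J₀3 : ℕ) : ℝ) + ((3 ^ P.J₀3 : ℕ) : ℝ) := by
      exact_mod_cast h
    linarith
  push_cast at h1
  have h2 := P.T3_ge_Lθ3
  have h3 : ((3 : ℝ) ^ P.J₀3) ≤ 3 * P.Lθ3 := by exact_mod_cast P.three_pow_le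
  have hL1 : (1 : ℝ) ≤ P.Lθ3 := by exact_mod_cast P.one_le_Lθ3
  have h4 : (2 : ℝ) ^ 9 * mRp d ^ 2 * P.nVθ ≤ (P.T3 : ℝ) / 3 ^ P.J₀3 := by
    rw [le_div_iff₀ (by positivity)]
    calc (2 : ℝ) ^ 9 * mRp d ^ 2 * P.nVθ * 3 ^ P.J₀3 ≤ 2 ^ 9 * mRp d ^ 2 * P.nVθ * (3 * P.Lθ3) := by
          have := P.one_le_nVθ; gcongr
      _ ≤ 2 ^ 11 * mRp d ^ 2 * P.nVθ * P.Lθ3 := by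
          have : (0 : ℝ) ≤ mRp d ^ 2 * P.nVθ * P.Lθ3 := by have := P.one_le_nVθ; positivity
          nlinarith
      _ ≤ P.T3 := h2
  linarith

/-- `kpts3 J₀ 0 ≥ L_θ · c_S m nW⋆` (real): the number of points of the top level
(`2·3^{J₀}·⌊c_S m nW⋆⌋ ≥ 2 L_θ (c_S m nW⋆ − 1)`). [folklore] -/
theorem kpts3_top_ge : (P.Lθ3 : ℝ) * (cSp * mRp d * P.nWstarℓ) ≤ (P.kpts3 P.J₀3 0 : ℝ) := by
  have h := P.kpts3_ge_real P.J₀3 0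
  rw [zero_add] at h
  have hJ : (P.Lθ3 : ℝ) ≤ (3 : ℝ) ^ P.J₀3 := by exact_mod_cast P.Lθ3_lt_three_pow.le
  have hcS := P.cS_mul_ge
  have hL0 : (0 : ℝ) ≤ P.Lθ3 := Nat.cast_nonneg _
  have h2 : cSp * mRp d * P.nWstarℓ ≤ 2 * (cSp * mRp d * P.nWstarℓ - 1) := by linarith
  calc (P.Lθ3 : ℝ) * (cSp * mRp d * P.nWstarℓ) ≤ (3 : ℝ) ^ P.J₀3 * (2 * (cSp * mRp d * P.nWstarℓ - 1)) :=
        mul_le_mul hJ h2 (by linarith) (by positivity)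
    _ = 2 * 3 ^ P.J₀3 * (cSp * mRp d * P.nWstarℓ - 1) := by ring
    _ ≤ (P.kpts3 P.J₀3 0 : ℝ) := h

/-- `L_θ nV_θ ≥ 𝔘/(18 c_L' c_S m² W⋆)` (`L_θ ≥ 𝔘/(6 c_L' m S₀ V_θ)`, `S₀ V_θ ≤ 3 c_S m W⋆ nV_θ`). [folklore] -/
theorem LθnVθ3_ge : P.𝔘3 / (18 * cLp' * cSp * mRp d ^ 2 * P.Wstarℓ) ≤ (P.Lθ3 : ℝ) * P.nVθ := by
  have hLθ := P.Lθ3_ge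
  have hden := P.den_Lθ3_pos
  have hS := P.S₀3_le; have hS0 := P.S₀3_pos
  have hm := mR_pos P; have hW := P.one_le_Wstar; have hU := P.𝔘3_pos; have hℓ := P.ℓ_pos; have hVθ := P.one_le_nVθ
  have e : P.Uℓ / (cLp' * mRp d * 3 ^ (d + 2) * P.S₀3 * P.Vθ) / 2 = P.𝔘3 / (6 * cLp' * mRp d * P.S₀3 * P.Vθ) := by
    rw [P.U_eq3, pow_succ]; field_simp; ring
  rw [e] at hLθ
  have hVθ0 : 0 < P.Vθ := by linarith [P.hVθ1]
  have hSW : (P.S₀3 : ℝ) * P.Vθ ≤ 3 * cSp * mRp d * P.Wstarℓ * P.nVθ := by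
    rw [P.Vθ_eq, P.Wstar_eq]
    have : (P.S₀3 : ℝ) * (P.ℓ * P.nVθ) = (P.S₀3 * P.ℓ) * P.nVθ := by ring
    rw [this]
    have hSℓ : (P.S₀3 : ℝ) * P.ℓ ≤ 3 * cSp * mRp d * (P.ℓ * P.nWstarℓ) := by
      calc (P.S₀3 : ℝ) * P.ℓ ≤ (3 * (cSp * mRp d * P.nWstarℓ)) * P.ℓ := mul_le_mul_of_nonneg_right hS hℓ.le
        _ = 3 * cSp * mRp d * (P.ℓ * P.nWstarℓ) := by ring
    exact mul_le_mul_of_nonneg_right hSℓ (by linarith)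
  have h2 : P.𝔘3 / (18 * cLp' * cSp * mRp d ^ 2 * P.Wstarℓ) ≤ P.𝔘3 / (6 * cLp' * mRp d * P.S₀3 * P.Vθ) * P.nVθ := by
    rw [div_mul_eq_mul_div, div_le_div_iff₀ (by unfold cLp' cSp; positivity) (by unfold cLp'; positivity)]
    have : 6 * cLp' * mRp d * ((P.S₀3 : ℝ) * P.Vθ) ≤ P.nVθ * (18 * cLp' * cSp * mRp d ^ 2 * P.Wstarℓ) := by
      have h6 : (0 : ℝ) ≤ 6 * cLp' * mRp d := by unfold cLp'; positivity
      calc 6 * cLp' * mRp d * ((P.S₀3 : ℝ) * P.Vθ) ≤ 6 * cLp' * mRp d * (3 * cSp * mRp d * P.Wstarℓ * P.nVθ) :=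
            mul_le_mul_of_nonneg_left hSW h6
        _ = P.nVθ * (18 * cLp' * cSp * mRp d ^ 2 * P.Wstarℓ) := by ring
    calc P.𝔘3 * (6 * cLp' * mRp d * (P.S₀3 : ℝ) * P.Vθ) = P.𝔘3 * (6 * cLp' * mRp d * ((P.S₀3 : ℝ) * P.Vθ)) := by ring
      _ ≤ P.𝔘3 * (P.nVθ * (18 * cLp' * cSp * mRp d ^ 2 * P.Wstarℓ)) := mul_le_mul_of_nonneg_left this hU.le
      _ = P.𝔘3 * P.nVθ * (18 * cLp' * cSp * mRp d ^ 2 * P.Wstarℓ) := by ring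
  calc P.𝔘3 / (18 * cLp' * cSp * mRp d ^ 2 * P.Wstarℓ) ≤ P.𝔘3 / (6 * cLp' * mRp d * P.S₀3 * P.Vθ) * P.nVθ := h2
    _ ≤ (P.Lθ3 : ℝ) * P.nVθ := mul_le_mul_of_nonneg_right hLθ (by linarith)

/-- **The numbers of the endgame at base 3**: `∑ⱼ ⌊Lⱼ/3^{J₀}⌋ + 1 ≤ ⌊T/3^{J₀}⌋` and
`h L_b < (⌊T/3^{J₀}⌋ − ∑ⱼ ⌊Lⱼ/3^{J₀}⌋) · kpts3 J₀ 0` (`kpts3 J₀ 0 = #{s < 3^{J₀} S₀ : 3 ∤ s}`; the product is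
`≥ 𝔘/(144ℓ)`, while `h L_b ≤ 𝔘/(2¹³ ℓ)`). [cite: Waldschmidt1980, §3.5 (p. 274)] [cite: Yu1989, §3] -/
theorem endgame_numbers3 :
    (∑ j, P.L3 j / 3 ^ P.J₀3) + 1 ≤ P.T3 / 3 ^ P.J₀3 ∧
      P.hparℓ * P.Lb3 < (P.T3 / 3 ^ P.J₀3 - ∑ j, P.L3 j / 3 ^ P.J₀3) * P.kpts3 P.J₀3 0 := by
  have hsum := P.sum_L3_div_le
  have hTd := P.T3_div_ge
  have hm := two_le_mR P; have hm0 := mR_pos P; have hVθ := P.one_le_nVθ; have hW := P.one_le_Wstar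
  have hU := P.𝔘3_pos; have hℓ := P.ℓ_pos; have hℓ1 := P.hℓ; have hnW := P.one_le_nWstar
  -- (1) the first claim, in the reals
  have h1real : ((∑ j, P.L3 j / 3 ^ P.J₀3 : ℕ) : ℝ) + 1 ≤ ((P.T3 / 3 ^ P.J₀3 : ℕ) : ℝ) := by
    have : 4 * mRp d * P.nVθ + 1 ≤ (2 : ℝ) ^ 9 * mRp d ^ 2 * P.nVθ - 1 := by nlinarith
    linarith
  have h1 : (∑ j, P.L3 j / 3 ^ P.J₀3) + 1 ≤ P.T3 / 3 ^ P.J₀3 := by exact_mod_cast h1real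
  refine ⟨h1, ?_⟩
  -- (2) the second claim
  have hsub : (((P.T3 / 3 ^ P.J₀3 - ∑ j, P.L3 j / 3 ^ P.J₀3 : ℕ)) : ℝ) =
      ((P.T3 / 3 ^ P.J₀3 : ℕ) : ℝ) - ((∑ j, P.L3 j / 3 ^ P.J₀3 : ℕ) : ℝ) := by
    rw [Nat.cast_sub (by omega)]
  have hT' : (2 : ℝ) ^ 8 * mRp d ^ 2 * P.nVθ ≤ ((P.T3 / 3 ^ P.J₀3 - ∑ j, P.L3 j / 3 ^ P.J₀3 : ℕ) : ℝ) := by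
    rw [hsub]; nlinarith
  have hK := P.kpts3_top_ge
  have hcS := P.cS_mul_ge
  have hLV := P.LθnVθ3_ge
  -- `h L_b ℓ ≤ 𝔘/2^13`
  have hlhs := P.hparLb3ℓ_le'
  suffices key : (P.hparℓ : ℝ) * P.Lb3 <
      ((P.T3 / 3 ^ P.J₀3 - ∑ j, P.L3 j / 3 ^ P.J₀3 : ℕ) : ℝ) * (P.kpts3 P.J₀3 0 : ℝ) by
    exact_mod_cast key
  have hprod : (2 : ℝ) ^ 8 * mRp d ^ 2 * P.nVθ * ((P.Lθ3 : ℝ) * (cSp * mRp d * P.nWstarℓ)) ≤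
      ((P.T3 / 3 ^ P.J₀3 - ∑ j, P.L3 j / 3 ^ P.J₀3 : ℕ) : ℝ) * (P.kpts3 P.J₀3 0 : ℝ) := by
    have hc : (0 : ℝ) < cSp := by unfold cSp; norm_num
    have h0 : (0 : ℝ) ≤ (P.Lθ3 : ℝ) * (cSp * mRp d * P.nWstarℓ) := by positivity
    exact mul_le_mul hT' hK h0 (Nat.cast_nonneg _)
  refine lt_of_lt_of_le ?_ hprod
  -- `2^8 m² nVθ Lθ c_S m nW⋆ = (2^8 c_S m³ nW⋆)(Lθ nVθ) ≥ 2^8 c_S m³ nW⋆ · 𝔘/(18 c_L' c_S m² W⋆) = 2^8 m 𝔘/(18 c_L' ℓ) ≥ 𝔘/(144 ℓ)`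
  have h144 : P.𝔘3 / (144 * P.ℓ) ≤ (2 : ℝ) ^ 8 * mRp d ^ 2 * P.nVθ * ((P.Lθ3 : ℝ) * (cSp * mRp d * P.nWstarℓ)) := by
    have e : (2 : ℝ) ^ 8 * mRp d ^ 2 * P.nVθ * ((P.Lθ3 : ℝ) * (cSp * mRp d * P.nWstarℓ)) =
        (2 ^ 8 * cSp * mRp d ^ 3 * P.nWstarℓ) * ((P.Lθ3 : ℝ) * P.nVθ) := by ring
    rw [e]
    have h0 : (0 : ℝ) ≤ 2 ^ 8 * cSp * mRp d ^ 3 * P.nWstarℓ := by unfold cSp; positivity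
    calc P.𝔘3 / (144 * P.ℓ) ≤ (2 ^ 8 * cSp * mRp d ^ 3 * P.nWstarℓ) * (P.𝔘3 / (18 * cLp' * cSp * mRp d ^ 2 * P.Wstarℓ)) := by
          unfold cLp' cSp
          rw [P.Wstar_eq, mul_div_assoc', div_le_div_iff₀ (by positivity) (by positivity)]
          have h0' : 0 ≤ mRp d ^ 2 * P.nWstarℓ * P.𝔘3 * P.ℓ := by positivity
          have h2m : 2 * (mRp d ^ 2 * P.nWstarℓ * P.𝔘3 * P.ℓ) ≤ mRp d * (mRp d ^ 2 * P.nWstarℓ * P.𝔘3 * P.ℓ) :=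
            mul_le_mul_of_nonneg_right hm h0'
          calc P.𝔘3 * (18 * (2 : ℝ) ^ 12 * 2 ^ 15 * mRp d ^ 2 * (P.ℓ * P.nWstarℓ))
              = 9 * 2 ^ 27 * (2 * (mRp d ^ 2 * P.nWstarℓ * P.𝔘3 * P.ℓ)) := by ring
            _ ≤ 9 * 2 ^ 27 * (mRp d * (mRp d ^ 2 * P.nWstarℓ * P.𝔘3 * P.ℓ)) := by linarith
            _ = 2 ^ 8 * 2 ^ 15 * mRp d ^ 3 * P.nWstarℓ * P.𝔘3 * (144 * P.ℓ) := by ring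
      _ ≤ (2 ^ 8 * cSp * mRp d ^ 3 * P.nWstarℓ) * ((P.Lθ3 : ℝ) * P.nVθ) := mul_le_mul_of_nonneg_left hLV h0
  have hlhs' : (P.hparℓ : ℝ) * P.Lb3 < P.𝔘3 / (144 * P.ℓ) := by
    rw [lt_div_iff₀ (by positivity)]
    calc (P.hparℓ : ℝ) * P.Lb3 * (144 * P.ℓ) = 144 * ((P.hparℓ : ℝ) * P.Lb3 * P.ℓ) := by ring
      _ ≤ 144 * (P.𝔘3 / 2 ^ 13) := by gcongr
      _ < P.𝔘3 := by linarith
  linarith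

end PadicW80ParL

end Summit.ABC.StewartYu

end
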